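import Literature.MathematicalPhysics.QuantumLattice.AnisotropicHeisenbergEnergyComparison
import Literature.MathematicalPhysics.QuantumLattice.HeisenbergOrderNeelTwoSumRule
import HarnessLib

/-!
# Kennedy–Lieb–Shastry 1988, eqs. (2)–(3) and (6)–(9) for the model (5): the two-sum-rule
# (linear-programming) bound on Néel order with direction-dependent couplings, finite volume

Topic `MathematicalPhysics/QuantumLattice`; the anisotropic companion of
`HeisenbergOrderNeelTwoSumRule.lean` (isotropic antiferromagnet), built on
`AnisotropicHeisenbergInfraredBound.lean` (the direction-resolved infrared bound) and
`AnisotropicHeisenbergEnergyComparison.lean` (`0 ≤ ρ₃ ≤ ρ₁`, Néel bound). No named fact is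
introduced; everything here is a theorem. Nothing numerical is asserted: the Riemann sums
`𝓦^K_{t,μ}(L)` stay symbolic.

## What is printed

Kennedy, Lieb and Shastry, J. Stat. Phys. **53** (1988) 1019–1030, p. 1023, for
`H = Σ J_{xy} 𝐒_x·𝐒_y`, `J = 1, 1, r` (eq. (5)): "(6) `0 ≤ g^r_q ≤ f^r_q`, `q ≠ Q`,
`f^r_q = (e^r_0 E^r_q/12E^r_{q-Q})^{1/2}` (7) … We now consider the following mathematical problem.
Assuming `m² = 0`, maximize `I = ∫d³q g_q` over all functions `g_q` subject to both inequality (6)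
and to (8) `∫d³q g_q (cos q₁ + cos q₂ + r cos q₃) = -e^r_0/3`, which is the analogue of (3) when
`r ≠ 1`. If the maximum of `I` is less than `1/4`, then we have a contradiction, so `m²` must be
nonzero, i.e., there must be Néel order. We claim that the maximum of `I` is attained either by
(9a) `g_q = f^r_q χ(cos q₁ + cos q₂ + r cos q₃ < α)` or (9b) `g_q = f^r_q χ(… > -α)` for some
`α ≥ 0` … We do not know the exact value of `e^r_0`, so we carry out this calculation for several
values of `e_0` ranging from the Néel bound of `(2+r)/4` to the Anderson bound of `(3+r)/4`."

## What is proved (finite volume, every `d`, every spin `S = n/2`, every `K > 0`, even side `2k ≥ 4`)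

The linear programme is proved in its DUAL form, with the `δ`-function weight
`m_L := |Λ|⁻¹ ĝ_Q` RETAINED (not assumed zero), and with one multiplier per sum rule — `t` for
the total sum rule (2) `|Λ|⁻¹Σ_q ĝ_q = S(S+1)/3` and `μᵢ` for each direction-resolved energy sum
rule (3ᵢ) `|Λ|⁻¹Σ_q ĝ_q cos qᵢ = εᵢ` (KLS's (8) is the combination `μ = λK`):

* `heisAniso_structureFactor_totalSumRule`, `heisAniso_structureFactor_dirSumRule` — (2), (3ᵢ);
* **`heisAniso_twoSumRule`** — for every real `t`, `μ` and every `s ≥ 0` with `-εᵢ ≤ s` for all `i`: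
  `t·S(S+1)/3 + Σᵢ μᵢ εᵢ - (s/2)^{1/2} 𝓦^K_{t,μ}(L) ≤ (t - Σᵢ μᵢ) · m_L`,
  `𝓦^K_{t,μ}(L) := L^{-d} Σ_{q ≠ Q} {t + Σᵢ μᵢ cos qᵢ}₊ (E^K_q/E^K_{q-Q})^{1/2}`
  (`heisAnisoKlsRiemannSum`; the cut-off half spaces (9a)/(9b) are the supports of the positive
  part); the infrared bound enters as `ĝ_q ≤ (s/2)^{1/2}(E^K_q/E^K_{q-Q})^{1/2}` (KLS (6)–(7) with
  `ρ_max/12·…`);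
* **`heisAniso_twoSumRule_kls`** — the printed one-parameter form: with `e := -Σᵢ Kᵢ εᵢ`
  (`= e₀/3`), a direction `i₀` of a largest coupling and a set `T` of directions carrying that
  coupling (`κ_T := Σ_{i∈T} Kᵢ`; `T = {1,2}`, `κ_T = 2` for `K = (1,1,r)`, `r ≤ 1`), and the
  multipliers `μ = λK` of (8): `t·S(S+1)/3 - λe - (e/2κ_T)^{1/2} 𝓦^K_{t,λK}(L) ≤ (t - λΣᵢKᵢ) m_L`
  — for `K = (1,1,r)`, `S = ½` exactly KLS's (6)–(8) (`f^r_q² = e₀E^r_q/12E^r_{q-Q}`);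
* the a-priori window of the unknown: `(S²/3)ΣᵢKᵢ ≤ e ≤ S²ΣᵢKᵢ` (`heisAniso_energy_window`;
  KLS: "`e₀` ranging from the Néel bound …");
* `heisAniso_neelSum_eq` — the staggered order parameter
  `|Λ|⁻² Σ_{x,y} (-1)^{x+y} Σ_α G^α_K(x,y) = 3 m_L`;
* **`heisAniso_neelOrder_of_certificate`** — Néel order along the even tori from finitely many
  eventual upper bounds `𝓦^K_{tⱼ,λⱼK}(2k) ≤ W̄ⱼ` and a real-arithmetic certificate covering the
  energy window (the form in which a certified evaluation of the KLS integrals is consumed);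
  `heisAniso_neelLRO_of_certificate` — the same as a `liminf` of the staggered order parameter;
* **`heisAniso_neelOrder_of_dirCertificate`**, `heisAniso_neelLRO_of_dirCertificate` — the
  stronger instrument with one free multiplier per sum rule (`μ : Fin d → ℝ`): the certificate
  quantifies over the a-priori region of the unknowns `(εᵢ)` cut out by (P) `εᵢ ≤ 0`,
  (X) `ε_{i₀} ≤ εᵢ`, (S) equal couplings ⇒ equal `ε`, (N) the Néel bound, (T) `|εᵢ| ≤ S²`
  (for `K = (1,1,r)`: KLS's two unknowns `ρ₁ = ρ₂ ≥ ρ₃ ≥ 0`).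

## References

* [KLS1988JSP] T. Kennedy, E. H. Lieb, B. S. Shastry, J. Stat. Phys. 53 (1988) 1019–1030,
  eqs. (2)–(3), (5)–(9), pp. 1021–1023, 1026.
* [DysonLiebSimon1978] F. J. Dyson, E. H. Lieb, B. Simon, J. Stat. Phys. 18 (1978) 335–383, §1.
-/

noncomputable section

open Filter Topology Matrix Finset
open Literature.MathematicalPhysics.QuantumLattice Literature.Probability.LatticeModels

namespace Literature.MathematicalPhysics.QuantumLattice

variable {d : ℕ}

/-! ### The sum rules (2) and (3ᵢ) for `H_K` -/

section SumRules

variable (L : ℕ) [NeZero L] (n : ℕ) (K : Fin d → ℝ)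

/-- The on-site value `G⁰_K(x,x) = S(S+1)/3` (on-site Casimir and isotropy).
[cite: KLS1988JSP, eq. (2)] -/
theorem heisAnisoGroundCorr_self (x : TorusSite d L) :
    heisAnisoGroundCorr 0 L n K x x = (n : ℝ) / 2 * ((n : ℝ) / 2 + 1) / 3 := by
  have hH := heisAnisoTorus_isHermitian L n K
  haveI : Nonempty (TensorIndex (TorusSite d L) (n + 1)) := ⟨fun _ => 0⟩
  have h3 : ∑ α : Fin 3, heisAnisoGroundCorr α L n K x x = (n : ℝ) / 2 * ((n : ℝ) / 2 + 1) := by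
    simp_rw [heisAnisoGroundCorr_of_neZero]
    rw [← Complex.re_sum, ← map_sum, sum_siteSpin_mul_siteSpin_holds n x, LinearMap.map_smul,
      groundStateFunctional_one hH, smul_eq_mul, mul_one]
    have : ((n : ℂ) / 2 * ((n : ℂ) / 2 + 1)) = (((n : ℝ) / 2 * ((n : ℝ) / 2 + 1) : ℝ) : ℂ) := by
      push_cast; ring
    rw [this, Complex.ofReal_re]
  rw [Fin.sum_univ_three, heisAnisoGroundCorr_one_eq_zero, heisAnisoGroundCorr_two_eq_zero] at h3
  linarith

/-- **The total sum rule (2) for `H_K`**: `Σ_q ĝ_q = |Λ| S(S+1)/3`. [cite: KLS1988JSP, eq. (2)] -/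
theorem heisAniso_structureFactor_totalSumRule :
    ∑ q : TorusSite d L, heisAnisoStructureFactor 0 L n K q =
      (L : ℝ) ^ d * ((n : ℝ) / 2 * ((n : ℝ) / 2 + 1) / 3) := by
  have hL1 : (L : ℝ) ≠ 0 := by exact_mod_cast NeZero.ne L
  have hL0 : (L : ℝ) ^ d ≠ 0 := pow_ne_zero _ hL1
  have hcard : (Fintype.card (TorusSite d L) : ℝ) = (L : ℝ) ^ d := by
    rw [Fintype.card_pi, prod_const, ZMod.card, card_univ, Fintype.card_fin]; push_cast; ring
  have h0 : ∀ q : TorusSite d L, Real.cos (torusPhase L q 0) = 1 := by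
    intro q; simp [torusPhase]
  have h := sum_structureFactor_mul_cos_torusPhase L (heisAnisoGroundCorr (d := d) 0 L n K)
    (heisAnisoGroundCorr_symm (d := d) L n K 0) (0 : TorusSite d L)
  simp_rw [h0, mul_one, add_zero, heisAnisoGroundCorr_self L n K, sum_const, card_univ, nsmul_eq_mul,
    hcard] at h
  simp_rw [heisAnisoStructureFactor_of_neZero]
  rw [← sum_div, h]
  field_simp

/-- **The direction-resolved energy sum rule (3ᵢ) for `H_K`**: `Σ_q ĝ_q cos qᵢ = |Λ| εᵢ`
(Parseval, `sum_structureFactor_mul_cos`) — KLS's (3)/(8) per lattice direction.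
[cite: KLS1988JSP, eqs. (3), (8)] -/
theorem heisAniso_structureFactor_dirSumRule (i : Fin d) :
    ∑ q : TorusSite d L, heisAnisoStructureFactor 0 L n K q * Real.cos (latticeMomentum L q i) =
      (L : ℝ) ^ d * heisAnisoDirBondCorr 0 L n K i := by
  have hL1 : (L : ℝ) ≠ 0 := by exact_mod_cast NeZero.ne L
  have hL0 : (L : ℝ) ^ d ≠ 0 := pow_ne_zero _ hL1
  have h := sum_structureFactor_mul_cos L (heisAnisoGroundCorr (d := d) 0 L n K)
    (heisAnisoGroundCorr_symm (d := d) L n K 0) i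
  simp_rw [heisAnisoStructureFactor_of_neZero, heisAnisoDirBondCorr_of_neZero, div_mul_eq_mul_div]
  rw [← sum_div, h]
  field_simp

end SumRules

/-! ### The two-sum-rule kernel and its punctured Riemann sum -/

/-- **The two-sum-rule multiplier** `κ_{t,μ}(q) = t + Σᵢ μᵢ cos qᵢ` at the dual-torus point `q`: the
combination "`t` × (2) `+ Σᵢ μᵢ` × (3ᵢ)" of the sum rules; KLS's (8) is `μ = λK`, and for the sign
of `λ` making `κ(Q) > 0` its positive part is supported on a half space of
`cos q₁ + cos q₂ + r cos q₃` — the maximisers (9a)/(9b). [cite: KLS1988JSP, eqs. (6)-(9)] -/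
def heisAnisoKernel (t : ℝ) (μ : Fin d → ℝ) (L : ℕ) (q : TorusSite d L) : ℝ :=
  t + ∑ i, μ i * Real.cos (latticeMomentum L q i)

/-- **The punctured Riemann sum of the two-sum-rule bound for the model (5)**,
`𝓦^K_{t,μ}(L) = L^{-d} Σ_{q ≠ Q} {κ_{t,μ}(q)}₊ (E^K_q/E^K_{q-Q})^{1/2}`, `E^K_q = ΣᵢKᵢ(1 - cos qᵢ)`
(junk `0` at `L = 0`). [cite: KLS1988JSP, eqs. (6)-(9)] -/
def heisAnisoKlsRiemannSum (K : Fin d → ℝ) (t : ℝ) (μ : Fin d → ℝ) (L : ℕ) : ℝ :=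
  if hL : L = 0 then 0
  else
    haveI : NeZero L := ⟨hL⟩
    (∑ q ∈ (univ : Finset (TorusSite d L)).erase (neelIndex L),
        max (heisAnisoKernel t μ L q) 0 *
          Real.sqrt (NVectorAniso.anisoDispersion K (latticeMomentum L q) /
            NVectorAniso.anisoDispersion K (latticeMomentum L (q - neelIndex L)))) / (L : ℝ) ^ d

/-- Unfolding `𝓦^K_{t,μ}(L)` on a genuine torus. [cite: KLS1988JSP, eqs. (6)-(9)] -/
theorem heisAnisoKlsRiemannSum_of_neZero (K : Fin d → ℝ) (t : ℝ) (μ : Fin d → ℝ) (L : ℕ) [NeZero L] :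
    heisAnisoKlsRiemannSum K t μ L =
      (∑ q ∈ (univ : Finset (TorusSite d L)).erase (neelIndex L),
          max (heisAnisoKernel t μ L q) 0 *
            Real.sqrt (NVectorAniso.anisoDispersion K (latticeMomentum L q) /
              NVectorAniso.anisoDispersion K (latticeMomentum L (q - neelIndex L)))) / (L : ℝ) ^ d := by
  simp [heisAnisoKlsRiemannSum, NeZero.ne L]

/-- `𝓦^K_{t,μ}(L) ≥ 0`. [cite: KLS1988JSP, eqs. (6)-(9)] -/
theorem heisAnisoKlsRiemannSum_nonneg (K : Fin d → ℝ) (t : ℝ) (μ : Fin d → ℝ) (L : ℕ) :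
    0 ≤ heisAnisoKlsRiemannSum K t μ L := by
  rcases Nat.eq_zero_or_pos L with rfl | hL
  · simp [heisAnisoKlsRiemannSum]
  haveI : NeZero L := ⟨hL.ne'⟩
  rw [heisAnisoKlsRiemannSum_of_neZero]
  refine div_nonneg (sum_nonneg fun q _ => mul_nonneg (le_max_right _ _) (Real.sqrt_nonneg _)) ?_
  positivity

/-- `κ_{t,μ}(Q) = t - Σᵢ μᵢ` (`cos Qᵢ = cos π = -1`): the coefficient of the Néel `δ`-function weight.
[cite: KLS1988JSP, eqs. (6)-(9)] -/
theorem heisAnisoKernel_neelIndex (t : ℝ) (μ : Fin d → ℝ) (k : ℕ) [NeZero (2 * k)] :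
    heisAnisoKernel t μ (2 * k) (neelIndex (2 * k) : TorusSite d (2 * k)) = t - ∑ i, μ i := by
  rw [heisAnisoKernel, sub_eq_add_neg, ← sum_neg_distrib]
  refine congrArg (t + ·) (sum_congr rfl fun i _ => ?_)
  rw [latticeMomentum_neelIndex k i, Real.cos_pi]
  ring

/-! ### The infrared bound with a common bound `s` on `-εᵢ` -/

/-- The direction-resolved infrared bound with every `-εᵢ` replaced by a common upper bound `s`:
`ĝ_q² E^K_{q-Q} ≤ (s/2) E^K_q` (`q ≠ Q`; `K > 0`). With `s = -ε_{i₀}` (largest coupling) this is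
`heisAniso_infraredBound_max`; with `s = e/κ_T` it is KLS's (6)–(7).
[cite: KLS1988JSP, eqs. (6)–(7), p. 1026] -/
theorem heisAniso_infraredBound_of_le (n k : ℕ) (hk : 2 ≤ k) {K : Fin d → ℝ} (hK : ∀ i, 0 < K i)
    {s : ℝ} (hs : ∀ i, -heisAnisoDirBondCorr 0 (2 * k) n K i ≤ s) (q : TorusSite d (2 * k))
    (hq : q ≠ neelIndex (2 * k)) :
    0 ≤ heisAnisoStructureFactor 0 (2 * k) n K q ∧
      heisAnisoStructureFactor 0 (2 * k) n K q ^ 2 *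
          NVectorAniso.anisoDispersion K (latticeMomentum (2 * k) (q - neelIndex (2 * k))) ≤
        s / 2 * NVectorAniso.anisoDispersion K (latticeMomentum (2 * k) q) := by
  obtain ⟨h0, hIR⟩ := heisAniso_infraredBound_ground n k hk hK q hq
  refine ⟨h0, hIR.trans ?_⟩
  rw [NVectorAniso.anisoDispersion, mul_sum, mul_sum]
  refine sum_le_sum fun i _ => ?_
  have hi := hs i
  have hw : 0 ≤ K i * (1 - Real.cos (latticeMomentum (2 * k) q i)) :=
    mul_nonneg (hK i).le (sub_nonneg.2 (Real.cos_le_one _))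
  nlinarith [mul_nonneg hw (sub_nonneg.2 hi)]

/-! ### The two-sum-rule bound (6)–(9) in finite volume, dual form -/

/-- **Kennedy–Lieb–Shastry's linear programme (6)–(9) for the model (5), finite volume, dual form,
direction-resolved multipliers.** On the even torus of side `L = 2k ≥ 4`, every `d`, every spin
`S = n/2`, every `K > 0`, every real `t`, `μ : Fin d → ℝ` and every `s ≥ 0` with `-εᵢ ≤ s` for
all `i`:
`t·S(S+1)/3 + Σᵢ μᵢ εᵢ - (s/2)^{1/2} 𝓦^K_{t,μ}(L) ≤ (t - Σᵢ μᵢ) · |Λ|⁻¹ ĝ_Q`.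
Proof: `t`×(2) `+ Σᵢμᵢ`×(3ᵢ) reads `|Λ|[t S(S+1)/3 + Σᵢμᵢεᵢ] = κ(Q) ĝ_Q + Σ_{q≠Q} κ(q) ĝ_q`, and
every `q ≠ Q` term is at most `{κ(q)}₊ (s/2)^{1/2}(E^K_q/E^K_{q-Q})^{1/2}` by the infrared bound.
With `m² := |Λ|⁻¹ĝ_Q` set to zero and `L → ∞` this is the infeasibility of KLS's programme, their
contradiction "max `I < 1/4`"; the multipliers parametrise the cut-off half spaces (9a)/(9b).
[cite: KLS1988JSP, eqs. (2), (3), (6)-(9)] -/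
theorem heisAniso_twoSumRule (n k : ℕ) (hk : 2 ≤ k) {K : Fin d → ℝ} (hK : ∀ i, 0 < K i)
    (t : ℝ) (μ : Fin d → ℝ) {s : ℝ} (hs0 : 0 ≤ s)
    (hs : ∀ i, -heisAnisoDirBondCorr 0 (2 * k) n K i ≤ s) :
    t * ((n : ℝ) / 2 * ((n : ℝ) / 2 + 1) / 3) + ∑ i, μ i * heisAnisoDirBondCorr 0 (2 * k) n K i -
        Real.sqrt (s / 2) * heisAnisoKlsRiemannSum K t μ (2 * k) ≤
      (t - ∑ i, μ i) *
        (heisAnisoStructureFactor 0 (2 * k) n K (neelIndex (2 * k) : TorusSite d (2 * k)) /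
          ((2 * k : ℕ) : ℝ) ^ d) := by
  haveI : NeZero (2 * k) := ⟨by omega⟩
  have h2k : (0 : ℝ) < ((2 * k : ℕ) : ℝ) := by exact_mod_cast (show 0 < 2 * k by omega)
  have hL : (0 : ℝ) < ((2 * k : ℕ) : ℝ) ^ d := pow_pos h2k d
  set Q : TorusSite d (2 * k) := neelIndex (2 * k) with hQ
  set c := (n : ℝ) / 2 * ((n : ℝ) / 2 + 1) / 3 with hc
  set g : TorusSite d (2 * k) → ℝ := fun q => heisAnisoStructureFactor 0 (2 * k) n K q with hg
  set ε : Fin d → ℝ := fun i => heisAnisoDirBondCorr 0 (2 * k) n K i with hε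
  have hs2 : 0 ≤ s / 2 := by positivity
  -- (2): `|Λ| c = ĝ_Q + Σ_{q ≠ Q} ĝ_q`
  have hT : ((2 * k : ℕ) : ℝ) ^ d * c =
      g Q + ∑ q ∈ (univ : Finset (TorusSite d (2 * k))).erase Q, g q := by
    rw [hc, ← heisAniso_structureFactor_totalSumRule (2 * k) n K, ← add_sum_erase _ _ (mem_univ Q)]
  -- (3ᵢ): `|Λ| εᵢ = -ĝ_Q + Σ_{q ≠ Q} ĝ_q cos qᵢ`
  have hE : ∀ i, ((2 * k : ℕ) : ℝ) ^ d * ε i =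
      -g Q + ∑ q ∈ (univ : Finset (TorusSite d (2 * k))).erase Q,
        g q * Real.cos (latticeMomentum (2 * k) q i) := by
    intro i
    rw [hε]
    dsimp only
    rw [← heisAniso_structureFactor_dirSumRule (2 * k) n K i, ← add_sum_erase _ _ (mem_univ Q), hQ,
      latticeMomentum_neelIndex k i, Real.cos_pi]
    ring
  -- the combination `t·(2) + Σᵢ μᵢ·(3ᵢ)`
  have hK' : ∑ q ∈ (univ : Finset (TorusSite d (2 * k))).erase Q, g q * heisAnisoKernel t μ (2 * k) q =
      t * ∑ q ∈ (univ : Finset (TorusSite d (2 * k))).erase Q, g q +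
        ∑ i, μ i * ∑ q ∈ (univ : Finset (TorusSite d (2 * k))).erase Q,
          g q * Real.cos (latticeMomentum (2 * k) q i) := by
    have hq : ∀ q : TorusSite d (2 * k), g q * heisAnisoKernel t μ (2 * k) q =
        t * g q + ∑ i, μ i * (g q * Real.cos (latticeMomentum (2 * k) q i)) := by
      intro q
      rw [heisAnisoKernel, mul_add, mul_sum]
      exact congrArg₂ (· + ·) (mul_comm _ _) (sum_congr rfl fun i _ => by ring)
    rw [sum_congr rfl fun q _ => hq q, sum_add_distrib, ← mul_sum, sum_comm]
    simp_rw [mul_sum]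
  have hcomb : (t - ∑ i, μ i) * g Q =
      ((2 * k : ℕ) : ℝ) ^ d * (t * c + ∑ i, μ i * ε i) -
        ∑ q ∈ (univ : Finset (TorusSite d (2 * k))).erase Q, g q * heisAnisoKernel t μ (2 * k) q := by
    rw [hK', mul_add, mul_sum]
    have hEi : ∀ i, μ i * (((2 * k : ℕ) : ℝ) ^ d * ε i) = μ i * (-g Q) +
        μ i * ∑ q ∈ (univ : Finset (TorusSite d (2 * k))).erase Q,
          g q * Real.cos (latticeMomentum (2 * k) q i) := fun i => by rw [hE i, mul_add]
    have hsumE : ∑ i, ((2 * k : ℕ) : ℝ) ^ d * (μ i * ε i) =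
        (∑ i, μ i) * (-g Q) + ∑ i, μ i * ∑ q ∈ (univ : Finset (TorusSite d (2 * k))).erase Q,
          g q * Real.cos (latticeMomentum (2 * k) q i) := by
      rw [sum_mul, ← sum_add_distrib]
      exact sum_congr rfl fun i _ => by rw [← hEi i]; ring
    rw [hsumE]
    linear_combination (-t) * hT
  -- termwise infrared bound on the punctured sum
  have hterm : ∀ q ∈ (univ : Finset (TorusSite d (2 * k))).erase Q,
      g q * heisAnisoKernel t μ (2 * k) q ≤
        Real.sqrt (s / 2) * (max (heisAnisoKernel t μ (2 * k) q) 0 *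
          Real.sqrt (NVectorAniso.anisoDispersion K (latticeMomentum (2 * k) q) /
            NVectorAniso.anisoDispersion K (latticeMomentum (2 * k) (q - Q)))) := by
    intro q hq
    have hqQ : q ≠ Q := (mem_erase.1 hq).1
    obtain ⟨hgq, hAq⟩ := heisAniso_infraredBound_of_le n k hk hK hs q hqQ
    have hE' : 0 < NVectorAniso.anisoDispersion K (latticeMomentum (2 * k) (q - Q)) :=
      anisoDispersion_latticeMomentum_pos (2 * k) hK (sub_ne_zero.2 hqQ)
    rw [hg, mul_comm]
    exact kls_heis_pointwise11 hgq hE' hs2 hAq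
  have hsum := sum_le_sum hterm
  rw [← mul_sum] at hsum
  rw [heisAnisoKlsRiemannSum_of_neZero, ← hQ]
  -- divide the combination by `|Λ|`
  have hgQ : g Q = heisAnisoStructureFactor 0 (2 * k) n K Q := rfl
  rw [← hgQ]
  have hkey : ((2 * k : ℕ) : ℝ) ^ d * (t * c + ∑ i, μ i * ε i) -
      Real.sqrt (s / 2) * ∑ q ∈ (univ : Finset (TorusSite d (2 * k))).erase Q,
        max (heisAnisoKernel t μ (2 * k) q) 0 *
          Real.sqrt (NVectorAniso.anisoDispersion K (latticeMomentum (2 * k) q) /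
            NVectorAniso.anisoDispersion K (latticeMomentum (2 * k) (q - Q))) ≤
      (t - ∑ i, μ i) * g Q := by
    rw [hcomb]
    linarith [hsum]
  have hdiv := div_le_div_of_nonneg_right hkey hL.le
  rw [mul_div_assoc] at hdiv
  refine le_trans (le_of_eq ?_) hdiv
  have hL0 : ((2 * k : ℕ) : ℝ) ^ d ≠ 0 := hL.ne'
  field_simp
  ring

/-- **The bound with the largest-coupling correlation** (`s = -ε_{i₀}`, KLS's "`0 ≤ ρ₃ ≤ ρ₁`").
[cite: KLS1988JSP, eqs. (6)-(9), p. 1026] -/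
theorem heisAniso_twoSumRule_max (n k : ℕ) (hk : 2 ≤ k) {K : Fin d → ℝ} (hK : ∀ i, 0 < K i)
    {i₀ : Fin d} (hmax : ∀ i, K i ≤ K i₀) (t : ℝ) (μ : Fin d → ℝ) :
    t * ((n : ℝ) / 2 * ((n : ℝ) / 2 + 1) / 3) + ∑ i, μ i * heisAnisoDirBondCorr 0 (2 * k) n K i -
        Real.sqrt (-heisAnisoDirBondCorr 0 (2 * k) n K i₀ / 2) * heisAnisoKlsRiemannSum K t μ (2 * k) ≤
      (t - ∑ i, μ i) *
        (heisAnisoStructureFactor 0 (2 * k) n K (neelIndex (2 * k) : TorusSite d (2 * k)) /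
          ((2 * k : ℕ) : ℝ) ^ d) := by
  haveI : NeZero (2 * k) := ⟨by omega⟩
  have hL3 : 3 ≤ 2 * k := by omega
  exact heisAniso_twoSumRule n k hk hK t μ
    (neg_nonneg.2 (heisAnisoDirBondCorr_nonpos k n hL3 (hK i₀)))
    (neg_heisAnisoDirBondCorr_le_of_isMax k n hL3 K hmax)

/-! ### The energy as the unknown: KLS's (6)–(8) -/

section Energy

variable (k : ℕ) [NeZero (2 * k)] (n : ℕ)

/-- `κ_T · (-ε_{i₀}) ≤ e` for a set `T` of directions carrying the largest coupling:
`e = Σᵢ Kᵢ(-εᵢ) ≥ Σ_{i∈T} Kᵢ(-εᵢ) = κ_T (-ε_{i₀})` ((P): all terms nonnegative; (S): equal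
couplings, equal correlations). For `K = (1,1,r)`, `T = {1,2}`: `ρ₁ ≤ e₀/2` ([KLS1988JSP] p. 1026:
"This fact, together with `e'₀ = 2ρ₁ + rρ₃`, implies …"). [cite: KLS1988JSP, p. 1026] -/
theorem mul_neg_heisAnisoDirBondCorr_le_energy (hL3 : 3 ≤ 2 * k) (K : Fin d → ℝ)
    {i₀ : Fin d} (T : Finset (Fin d)) (hT : ∀ i ∈ T, K i = K i₀) :
    (∑ i ∈ T, K i) * (-heisAnisoDirBondCorr 0 (2 * k) n K i₀) ≤
      -∑ i, K i * heisAnisoDirBondCorr 0 (2 * k) n K i := by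
  have hTi : ∀ i ∈ T, heisAnisoDirBondCorr 0 (2 * k) n K i = heisAnisoDirBondCorr 0 (2 * k) n K i₀ :=
    fun i hi => heisAnisoDirBondCorr_eq_of_coupling_eq (2 * k) n hL3 K 0 (hT i hi)
  calc (∑ i ∈ T, K i) * (-heisAnisoDirBondCorr 0 (2 * k) n K i₀)
      = ∑ i ∈ T, -(K i * heisAnisoDirBondCorr 0 (2 * k) n K i) := by
        rw [sum_mul]
        exact sum_congr rfl fun i hi => by rw [hTi i hi]; ring
    _ ≤ ∑ i, -(K i * heisAnisoDirBondCorr 0 (2 * k) n K i) :=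
        sum_le_sum_of_subset_of_nonneg (subset_univ T) fun i _ _ =>
          neg_nonneg.2 (mul_heisAnisoDirBondCorr_nonpos k n hL3 K i)
    _ = -∑ i, K i * heisAnisoDirBondCorr 0 (2 * k) n K i := by rw [sum_neg_distrib]

/-- **The a-priori window of the energy** `e := -Σᵢ Kᵢ εᵢ` (`= e₀/3`): `(S²/3) Σᵢ Kᵢ ≤ e ≤ S² Σᵢ Kᵢ`
for `K ≥ 0` — the Néel bound (N) below and the operator bound (T) above (KLS: "`e₀` ranging from
the Néel bound of `(2+r)/4` to the Anderson bound of `(3+r)/4`"; here the weaker upper end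
`3(2+r)/4` of (T)). [cite: KLS1988JSP, p. 1023] -/
theorem heisAniso_energy_window (hL3 : 3 ≤ 2 * k) {K : Fin d → ℝ} (hK : ∀ i, 0 ≤ K i) :
    ((n : ℝ) / 2) ^ 2 / 3 * ∑ i, K i ≤ -∑ i, K i * heisAnisoDirBondCorr 0 (2 * k) n K i ∧
      -∑ i, K i * heisAnisoDirBondCorr 0 (2 * k) n K i ≤ ((n : ℝ) / 2) ^ 2 * ∑ i, K i := by
  refine ⟨by linarith [sum_mul_heisAnisoDirBondCorr_le_neel k n hL3 K], ?_⟩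
  rw [← sum_neg_distrib, mul_sum]
  refine sum_le_sum fun i _ => ?_
  have h := heisAnisoDirBondCorr_abs_le (2 * k) n K 0 i
  rw [abs_le] at h
  nlinarith [h.1, hK i]

/-- **Kennedy–Lieb–Shastry's (6)–(8), finite volume, dual form, the energy as the unknown.** On
the even torus of side `2k ≥ 4`, every `d`, every spin `S = n/2`, every `K > 0` with a largest
coupling `K_{i₀}` carried by the directions of `T` (`κ_T = Σ_{i∈T}Kᵢ > 0`), and every real `t`,
`λ`: with `e := -Σᵢ Kᵢ εᵢ` and the multipliers `μ = λK` of (8),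
`t·S(S+1)/3 - λ e - (e/2κ_T)^{1/2} 𝓦^K_{t,λK}(L) ≤ (t - λ ΣᵢKᵢ) · |Λ|⁻¹ ĝ_Q`.
For `K = (1, 1, r)`, `0 < r ≤ 1`, `T = {1,2}`, `S = ½`: `(e/4)^{1/2} = (e₀/12)^{1/2}` and the
kernel is `t + λ(cos q₁ + cos q₂ + r cos q₃)` — exactly the programme (6)–(8) with maximisers
(9a)/(9b), `m² = |Λ|⁻¹ĝ_Q` retained. [cite: KLS1988JSP, eqs. (5)-(9), p. 1026] -/
theorem heisAniso_twoSumRule_kls (hk : 2 ≤ k) {K : Fin d → ℝ} (hK : ∀ i, 0 < K i) {i₀ : Fin d}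
    (hmax : ∀ i, K i ≤ K i₀) (T : Finset (Fin d)) (hT : ∀ i ∈ T, K i = K i₀)
    (hκ : 0 < ∑ i ∈ T, K i) (t lam : ℝ) :
    t * ((n : ℝ) / 2 * ((n : ℝ) / 2 + 1) / 3) - lam * (-∑ i, K i * heisAnisoDirBondCorr 0 (2 * k) n K i) -
        Real.sqrt (-(∑ i, K i * heisAnisoDirBondCorr 0 (2 * k) n K i) / (2 * ∑ i ∈ T, K i)) *
          heisAnisoKlsRiemannSum K t (fun i => lam * K i) (2 * k) ≤
      (t - lam * ∑ i, K i) *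
        (heisAnisoStructureFactor 0 (2 * k) n K (neelIndex (2 * k) : TorusSite d (2 * k)) /
          ((2 * k : ℕ) : ℝ) ^ d) := by
  have hL3 : 3 ≤ 2 * k := by omega
  set e := -∑ i, K i * heisAnisoDirBondCorr 0 (2 * k) n K i with he
  set s := -heisAnisoDirBondCorr 0 (2 * k) n K i₀ with hs
  have hs0 : 0 ≤ s := neg_nonneg.2 (heisAnisoDirBondCorr_nonpos k n hL3 (hK i₀))
  have hse : (∑ i ∈ T, K i) * s ≤ e := mul_neg_heisAnisoDirBondCorr_le_energy k n hL3 K T hT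
  have hmain := heisAniso_twoSumRule_max n k hk hK hmax t (fun i => lam * K i)
  have hμ : ∑ i, lam * K i * heisAnisoDirBondCorr 0 (2 * k) n K i = -(lam * e) := by
    rw [he, mul_neg, neg_neg, mul_sum]
    exact sum_congr rfl fun i _ => by ring
  have hμ' : ∑ i, lam * K i = lam * ∑ i, K i := by rw [mul_sum]
  rw [hμ, hμ'] at hmain
  -- `√(s/2) ≤ √(e/(2κ_T))` and `𝓦 ≥ 0`
  have hsqrt : Real.sqrt (s / 2) ≤ Real.sqrt (e / (2 * ∑ i ∈ T, K i)) := by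
    refine Real.sqrt_le_sqrt ?_
    rw [div_le_div_iff₀ (by norm_num : (0 : ℝ) < 2) (by positivity)]
    nlinarith [hse]
  have hW := heisAnisoKlsRiemannSum_nonneg K t (fun i => lam * K i) (2 * k)
  have hprod := mul_le_mul_of_nonneg_right hsqrt hW
  linarith [hmain, hprod]

end Energy

/-! ### The staggered order parameter and Néel order from a certificate -/

section NeelOrder

/-- **The Néel order parameter of `H_K`.** On the even torus of side `2k`, the staggered,
volume-normalised double sum of `Σ_α G^α_K(x,y) = ⟨𝐒_x·𝐒_y⟩` is `3 |Λ|⁻¹ ĝ_Q` (isotropy (I) and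
`cos(Q·(x-y)) = (-1)^x(-1)^y`). [Kennedy–Lieb–Shastry 1988, p. 1021 ("Néel order corresponds to
`g_q` containing a `δ` function at `Q`. Let `m²` be the coefficient")] [cite: KLS1988JSP, p. 1021] -/
theorem heisAniso_neelSum_eq (n k : ℕ) [NeZero (2 * k)] (K : Fin d → ℝ) :
    (∑ x : TorusSite d (2 * k), ∑ y : TorusSite d (2 * k),
        (-1 : ℝ) ^ (∑ i, (x i).val) * (-1) ^ (∑ i, (y i).val) *
          ∑ α : Fin 3, heisAnisoGroundCorr α (2 * k) n K x y) / ((2 * k : ℕ) : ℝ) ^ (2 * d) =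
      3 * (heisAnisoStructureFactor 0 (2 * k) n K (neelIndex (2 * k) : TorusSite d (2 * k)) /
        ((2 * k : ℕ) : ℝ) ^ d) := by
  have h2k : ((2 * k : ℕ) : ℝ) ≠ 0 := by exact_mod_cast NeZero.ne (2 * k)
  have hL : ((2 * k : ℕ) : ℝ) ^ d ≠ 0 := pow_ne_zero _ h2k
  rw [heisAnisoStructureFactor_of_neZero, div_div, ← pow_add, show d + d = 2 * d by ring,
    mul_div_assoc', mul_sum]
  refine congrArg (· / ((2 * k : ℕ) : ℝ) ^ (2 * d)) ?_
  refine sum_congr rfl fun x _ => ?_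
  rw [mul_sum]
  refine sum_congr rfl fun y _ => ?_
  rw [cos_torusPhase_neelIndex_sub k, Fin.sum_univ_three, heisAnisoGroundCorr_one_eq_zero,
    heisAnisoGroundCorr_two_eq_zero]
  ring

/-- The order-parameter sequence is bounded: `|L^{-2d} Σ_{x,y} ± Σ_α G^α| ≤ 3S²` (from (T)).
[cite: KLS1988JSP, p. 1021] -/
theorem heisAniso_neelSum_le (n L : ℕ) [NeZero L] (K : Fin d → ℝ) :
    (∑ x : TorusSite d L, ∑ y : TorusSite d L,
        (-1 : ℝ) ^ (∑ i, (x i).val) * (-1) ^ (∑ i, (y i).val) *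
          ∑ α : Fin 3, heisAnisoGroundCorr α L n K x y) / (L : ℝ) ^ (2 * d) ≤ 3 * ((n : ℝ) / 2) ^ 2 := by
  have hL0 : (0 : ℝ) < L := by exact_mod_cast Nat.pos_of_ne_zero (NeZero.ne L)
  have hLpos : (0 : ℝ) < (L : ℝ) ^ (2 * d) := by positivity
  rw [div_le_iff₀ hLpos]
  have hb : ∀ x y : TorusSite d L, (-1 : ℝ) ^ (∑ i, (x i).val) * (-1) ^ (∑ i, (y i).val) *
      ∑ α : Fin 3, heisAnisoGroundCorr α L n K x y ≤ 3 * ((n : ℝ) / 2) ^ 2 := by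
    intro x y
    have h3 : |∑ α : Fin 3, heisAnisoGroundCorr α L n K x y| ≤ 3 * ((n : ℝ) / 2) ^ 2 := by
      calc |∑ α : Fin 3, heisAnisoGroundCorr α L n K x y|
          ≤ ∑ α : Fin 3, |heisAnisoGroundCorr α L n K x y| := abs_sum_le_sum_abs _ _
        _ ≤ ∑ _α : Fin 3, ((n : ℝ) / 2) ^ 2 :=
            sum_le_sum fun α _ => heisAnisoGroundCorr_abs_le L n K α x y
        _ = 3 * ((n : ℝ) / 2) ^ 2 := by simp
    have hs : |(-1 : ℝ) ^ (∑ i, (x i).val) * (-1) ^ (∑ i, (y i).val)| = 1 := by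
      rw [abs_mul, abs_neg_one_pow, abs_neg_one_pow, mul_one]
    have := abs_mul ((-1 : ℝ) ^ (∑ i, (x i).val) * (-1) ^ (∑ i, (y i).val))
      (∑ α : Fin 3, heisAnisoGroundCorr α L n K x y)
    rw [hs, one_mul] at this
    exact (le_abs_self _).trans (this ▸ h3)
  calc ∑ x : TorusSite d L, ∑ y : TorusSite d L, (-1 : ℝ) ^ (∑ i, (x i).val) *
        (-1) ^ (∑ i, (y i).val) * ∑ α : Fin 3, heisAnisoGroundCorr α L n K x y
      ≤ ∑ _x : TorusSite d L, ∑ _y : TorusSite d L, 3 * ((n : ℝ) / 2) ^ 2 :=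
        sum_le_sum fun x _ => sum_le_sum fun y _ => hb x y
    _ = 3 * ((n : ℝ) / 2) ^ 2 * (L : ℝ) ^ (2 * d) := by
        rw [sum_const, sum_const, card_univ, nsmul_eq_mul, nsmul_eq_mul, Fintype.card_pi, prod_const,
          ZMod.card, card_univ, Fintype.card_fin]
        push_cast
        ring

/-- The square root against a tangent line: `√e ≤ (e + c)/(2√c)` for `c > 0` (used to turn the
convex function `e ↦ -λe - (e/2κ)^{1/2} W̄` of a certificate into linear endpoint checks).
[cite: KLS1988JSP, p. 1023] -/
theorem Real.sqrt_le_add_div_two_mul_sqrt {e c : ℝ} (he : 0 ≤ e) (hc : 0 < c) :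
    Real.sqrt e ≤ (e + c) / (2 * Real.sqrt c) := by
  have hsc : 0 < Real.sqrt c := Real.sqrt_pos.2 hc
  rw [le_div_iff₀ (by positivity)]
  nlinarith [sq_nonneg (Real.sqrt e - Real.sqrt c), Real.sq_sqrt he, Real.sq_sqrt hc.le,
    Real.sqrt_nonneg e]

/-- **Néel order for the model (5) from a certificate** (the form in which certified values of
the KLS integrals are consumed). Data: `K > 0` with a largest coupling `K_{i₀}` carried by `T`
(`κ_T > 0`), spin `S = n/2`, a finite index set `J` of triples `(tⱼ, λⱼ, W̄ⱼ)` with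
`tⱼ - λⱼ ΣK > 0` and, along the even sides, eventually `𝓦^K_{tⱼ,λⱼK}(2k) ≤ W̄ⱼ`; and a margin
`δ` such that every energy `e` of the a-priori window `[(S²/3)ΣK, S²ΣK]` admits a `j ∈ J` with
`δ (tⱼ - λⱼΣK) ≤ tⱼ S(S+1)/3 - λⱼ e - (e/2κ_T)^{1/2} W̄ⱼ`. Then eventually `|Λ|⁻¹ĝ_Q ≥ δ`, i.e. the
staggered order parameter `|Λ|⁻² Σ_{x,y}(-1)^{x+y}⟨𝐒_x·𝐒_y⟩ ≥ 3δ` on all large even tori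
(KLS p. 1023: "If the maximum of `I` is less than `1/4`, then … there must be Néel order",
quantitatively and with `e₀` ranging over its window). [cite: KLS1988JSP, eqs. (5)-(9), p. 1023] -/
theorem heisAniso_neelOrder_of_certificate {n : ℕ} {K : Fin d → ℝ} (hK : ∀ i, 0 < K i) {i₀ : Fin d}
    (hmax : ∀ i, K i ≤ K i₀) (T : Finset (Fin d)) (hT : ∀ i ∈ T, K i = K i₀) (hκ : 0 < ∑ i ∈ T, K i)
    {ι : Type*} (J : Finset ι) (t lam Wbar : ι → ℝ) (hpos : ∀ j ∈ J, 0 < t j - lam j * ∑ i, K i)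
    (hW : ∀ j ∈ J, ∀ᶠ k : ℕ in atTop,
      heisAnisoKlsRiemannSum K (t j) (fun i => lam j * K i) (2 * k) ≤ Wbar j)
    {δ : ℝ}
    (hcert : ∀ e : ℝ, ((n : ℝ) / 2) ^ 2 / 3 * ∑ i, K i ≤ e → e ≤ ((n : ℝ) / 2) ^ 2 * ∑ i, K i →
      ∃ j ∈ J, δ * (t j - lam j * ∑ i, K i) ≤
        t j * ((n : ℝ) / 2 * ((n : ℝ) / 2 + 1) / 3) - lam j * e -
          Real.sqrt (e / (2 * ∑ i ∈ T, K i)) * Wbar j) :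
    ∀ᶠ k : ℕ in atTop,
      δ ≤ heisAnisoStructureFactor 0 (2 * k) n K (neelIndex (2 * k) : TorusSite d (2 * k)) /
        ((2 * k : ℕ) : ℝ) ^ d := by
  have hall : ∀ᶠ k : ℕ in atTop, ∀ j ∈ J,
      heisAnisoKlsRiemannSum K (t j) (fun i => lam j * K i) (2 * k) ≤ Wbar j :=
    (J.eventually_all).2 hW
  filter_upwards [hall, eventually_ge_atTop 2] with k hk hk2
  haveI : NeZero (2 * k) := ⟨by omega⟩
  have hL3 : 3 ≤ 2 * k := by omega
  set e := -∑ i, K i * heisAnisoDirBondCorr 0 (2 * k) n K i with he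
  obtain ⟨hlo, hhi⟩ := heisAniso_energy_window k n hL3 (fun i => (hK i).le)
  obtain ⟨j, hj, hcj⟩ := hcert e hlo hhi
  have hmain := heisAniso_twoSumRule_kls k n hk2 hK hmax T hT hκ (t j) (lam j)
  rw [← he] at hmain
  have hsq : 0 ≤ Real.sqrt (e / (2 * ∑ i ∈ T, K i)) := Real.sqrt_nonneg _
  have hWk := hk j hj
  have h1 : t j * ((n : ℝ) / 2 * ((n : ℝ) / 2 + 1) / 3) - lam j * e -
      Real.sqrt (e / (2 * ∑ i ∈ T, K i)) * Wbar j ≤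
      t j * ((n : ℝ) / 2 * ((n : ℝ) / 2 + 1) / 3) - lam j * e -
        Real.sqrt (e / (2 * ∑ i ∈ T, K i)) *
          heisAnisoKlsRiemannSum K (t j) (fun i => lam j * K i) (2 * k) := by
    nlinarith [mul_le_mul_of_nonneg_left hWk hsq]
  have h2 := (hcj.trans h1).trans hmain
  exact le_of_mul_le_mul_left (by linarith [h2]) (hpos j hj)

/-- **Néel order from a certificate, direction-resolved multipliers** (the stronger instrument:
one multiplier per sum rule (2), (3ᵢ)). Data: `K > 0` with a largest coupling `K_{i₀}`, spin
`S = n/2`, finitely many `(tⱼ, μⱼ, W̄ⱼ)` with `tⱼ - Σᵢμⱼᵢ > 0` and eventually `𝓦^K_{tⱼ,μⱼ}(2k) ≤ W̄ⱼ`,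
and a margin `δ` such that EVERY vector `ε` in the a-priori region — (P) `εᵢ ≤ 0`, (X) `ε_{i₀} ≤ εᵢ`,
(S) `Kᵢ = K_{i₀} ⇒ εᵢ = ε_{i₀}`, (N) `ΣKᵢεᵢ ≤ -(S²/3)ΣKᵢ`, (T) `-S² ≤ εᵢ` — admits `j ∈ J` with
`δ(tⱼ - Σᵢμⱼᵢ) ≤ tⱼS(S+1)/3 + Σᵢ μⱼᵢ εᵢ - (-ε_{i₀}/2)^{1/2} W̄ⱼ`. Then eventually `|Λ|⁻¹ĝ_Q ≥ δ`.
(For `K = (1,1,r)` the region is the polygon `0 ≤ ρ₃ ≤ ρ₁ ≤ 3S²`, `2ρ₁ + rρ₃ ≥ (2+r)S²` of KLS's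
two unknowns `ρ₁ = ρ₂`, `ρ₃`.) [cite: KLS1988JSP, eqs. (5)-(9), pp. 1023, 1026] -/
theorem heisAniso_neelOrder_of_dirCertificate {n : ℕ} {K : Fin d → ℝ} (hK : ∀ i, 0 < K i)
    {i₀ : Fin d} (hmax : ∀ i, K i ≤ K i₀) {ι : Type*} (J : Finset ι) (t : ι → ℝ)
    (μ : ι → Fin d → ℝ) (Wbar : ι → ℝ) (hpos : ∀ j ∈ J, 0 < t j - ∑ i, μ j i)
    (hW : ∀ j ∈ J, ∀ᶠ k : ℕ in atTop, heisAnisoKlsRiemannSum K (t j) (μ j) (2 * k) ≤ Wbar j)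
    {δ : ℝ}
    (hcert : ∀ ε : Fin d → ℝ, (∀ i, ε i ≤ 0) → (∀ i, ε i₀ ≤ ε i) →
      (∀ i, K i = K i₀ → ε i = ε i₀) →
      (∑ i, K i * ε i ≤ -(((n : ℝ) / 2) ^ 2 / 3) * ∑ i, K i) → (∀ i, -((n : ℝ) / 2) ^ 2 ≤ ε i) →
      ∃ j ∈ J, δ * (t j - ∑ i, μ j i) ≤
        t j * ((n : ℝ) / 2 * ((n : ℝ) / 2 + 1) / 3) + ∑ i, μ j i * ε i -
          Real.sqrt (-ε i₀ / 2) * Wbar j) :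
    ∀ᶠ k : ℕ in atTop,
      δ ≤ heisAnisoStructureFactor 0 (2 * k) n K (neelIndex (2 * k) : TorusSite d (2 * k)) /
        ((2 * k : ℕ) : ℝ) ^ d := by
  have hall : ∀ᶠ k : ℕ in atTop, ∀ j ∈ J,
      heisAnisoKlsRiemannSum K (t j) (μ j) (2 * k) ≤ Wbar j :=
    (J.eventually_all).2 hW
  filter_upwards [hall, eventually_ge_atTop 2] with k hk hk2
  haveI : NeZero (2 * k) := ⟨by omega⟩
  have hL3 : 3 ≤ 2 * k := by omega
  set ε : Fin d → ℝ := fun i => heisAnisoDirBondCorr 0 (2 * k) n K i with hε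
  have hP : ∀ i, ε i ≤ 0 := fun i => heisAnisoDirBondCorr_nonpos k n hL3 (hK i)
  have hX : ∀ i, ε i₀ ≤ ε i := fun i =>
    heisAnisoDirBondCorr_le_of_coupling_le (2 * k) n hL3 K (hmax i)
  have hS : ∀ i, K i = K i₀ → ε i = ε i₀ := fun i hi =>
    heisAnisoDirBondCorr_eq_of_coupling_eq (2 * k) n hL3 K 0 hi
  have hN : ∑ i, K i * ε i ≤ -(((n : ℝ) / 2) ^ 2 / 3) * ∑ i, K i :=
    sum_mul_heisAnisoDirBondCorr_le_neel k n hL3 K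
  have hTb : ∀ i, -((n : ℝ) / 2) ^ 2 ≤ ε i := fun i => by
    have h := heisAnisoDirBondCorr_abs_le (2 * k) n K 0 i
    rw [abs_le] at h
    exact h.1
  obtain ⟨j, hj, hcj⟩ := hcert ε hP hX hS hN hTb
  have hmain := heisAniso_twoSumRule_max n k hk2 hK hmax (t j) (μ j)
  have hsq : 0 ≤ Real.sqrt (-ε i₀ / 2) := Real.sqrt_nonneg _
  have hWk := hk j hj
  have h1 : t j * ((n : ℝ) / 2 * ((n : ℝ) / 2 + 1) / 3) + ∑ i, μ j i * ε i -
      Real.sqrt (-ε i₀ / 2) * Wbar j ≤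
      t j * ((n : ℝ) / 2 * ((n : ℝ) / 2 + 1) / 3) + ∑ i, μ j i * ε i -
        Real.sqrt (-ε i₀ / 2) * heisAnisoKlsRiemannSum K (t j) (μ j) (2 * k) := by
    nlinarith [mul_le_mul_of_nonneg_left hWk hsq]
  have h2 := (hcj.trans h1).trans hmain
  exact le_of_mul_le_mul_left (by linarith [h2]) (hpos j hj)

/-- **Néel long-range order from a direction-resolved certificate**, as a `liminf`: under the
hypotheses of `heisAniso_neelOrder_of_dirCertificate`,
`liminf_k |Λ_k|⁻² Σ_{x,y} (-1)^{x+y} Σ_α G^α_K(x,y) ≥ 3δ` along the even tori.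
[cite: KLS1988JSP, eqs. (5)-(9), p. 1023] -/
theorem heisAniso_neelLRO_of_dirCertificate {n : ℕ} {K : Fin d → ℝ} (hK : ∀ i, 0 < K i)
    {i₀ : Fin d} (hmax : ∀ i, K i ≤ K i₀) {ι : Type*} (J : Finset ι) (t : ι → ℝ)
    (μ : ι → Fin d → ℝ) (Wbar : ι → ℝ) (hpos : ∀ j ∈ J, 0 < t j - ∑ i, μ j i)
    (hW : ∀ j ∈ J, ∀ᶠ k : ℕ in atTop, heisAnisoKlsRiemannSum K (t j) (μ j) (2 * k) ≤ Wbar j)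
    {δ : ℝ}
    (hcert : ∀ ε : Fin d → ℝ, (∀ i, ε i ≤ 0) → (∀ i, ε i₀ ≤ ε i) →
      (∀ i, K i = K i₀ → ε i = ε i₀) →
      (∑ i, K i * ε i ≤ -(((n : ℝ) / 2) ^ 2 / 3) * ∑ i, K i) → (∀ i, -((n : ℝ) / 2) ^ 2 ≤ ε i) →
      ∃ j ∈ J, δ * (t j - ∑ i, μ j i) ≤
        t j * ((n : ℝ) / 2 * ((n : ℝ) / 2 + 1) / 3) + ∑ i, μ j i * ε i -
          Real.sqrt (-ε i₀ / 2) * Wbar j) :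
    3 * δ ≤ liminf (fun k : ℕ =>
      (∑ x : TorusSite d (2 * k + 2), ∑ y : TorusSite d (2 * k + 2),
        (-1 : ℝ) ^ (∑ i, (x i).val) * (-1) ^ (∑ i, (y i).val) *
          ∑ α : Fin 3, heisAnisoGroundCorr α (2 * k + 2) n K x y) /
        ((2 * k + 2 : ℕ) : ℝ) ^ (2 * d)) atTop := by
  have hev := heisAniso_neelOrder_of_dirCertificate hK hmax J t μ Wbar hpos hW hcert
  have h2k : Tendsto (fun k : ℕ => k + 1) atTop atTop :=
    tendsto_atTop_atTop.2 fun b => ⟨b, fun k hk => by omega⟩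
  have hev' := h2k.eventually hev
  refine le_liminf_of_le ?_ ?_
  · exact isCoboundedUnder_ge_of_le atTop fun k => by
      haveI : NeZero (2 * k + 2) := ⟨by omega⟩
      exact heisAniso_neelSum_le n (2 * k + 2) K
  · filter_upwards [hev'] with k hk
    haveI : NeZero (2 * (k + 1)) := ⟨by omega⟩
    show 3 * δ ≤ (∑ x : TorusSite d (2 * (k + 1)), ∑ y : TorusSite d (2 * (k + 1)),
        (-1 : ℝ) ^ (∑ i, (x i).val) * (-1) ^ (∑ i, (y i).val) *
          ∑ α : Fin 3, heisAnisoGroundCorr α (2 * (k + 1)) n K x y) / ((2 * (k + 1) : ℕ) : ℝ) ^ (2 * d)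
    rw [heisAniso_neelSum_eq n (k + 1) K]
    have hk' : δ ≤ heisAnisoStructureFactor 0 (2 * (k + 1)) n K (neelIndex (2 * (k + 1))) /
        ((2 * (k + 1) : ℕ) : ℝ) ^ d := hk
    linarith

/-- **Néel long-range order of the model (5) from a certificate**, as a `liminf`:
under the hypotheses of `heisAniso_neelOrder_of_certificate` with `δ > 0`,
`liminf_k |Λ_k|⁻² Σ_{x,y} (-1)^{x+y} Σ_α G^α_K(x,y) ≥ 3δ > 0` along the even tori `(ℤ/2kℤ)^d`.
[cite: KLS1988JSP, Theorem (p. 1023: "this model has Néel order if `1 ≥ r ≥ 0.16` and `S = 1/2`")] -/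
theorem heisAniso_neelLRO_of_certificate {n : ℕ} {K : Fin d → ℝ} (hK : ∀ i, 0 < K i) {i₀ : Fin d}
    (hmax : ∀ i, K i ≤ K i₀) (T : Finset (Fin d)) (hT : ∀ i ∈ T, K i = K i₀) (hκ : 0 < ∑ i ∈ T, K i)
    {ι : Type*} (J : Finset ι) (t lam Wbar : ι → ℝ) (hpos : ∀ j ∈ J, 0 < t j - lam j * ∑ i, K i)
    (hW : ∀ j ∈ J, ∀ᶠ k : ℕ in atTop,
      heisAnisoKlsRiemannSum K (t j) (fun i => lam j * K i) (2 * k) ≤ Wbar j)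
    {δ : ℝ}
    (hcert : ∀ e : ℝ, ((n : ℝ) / 2) ^ 2 / 3 * ∑ i, K i ≤ e → e ≤ ((n : ℝ) / 2) ^ 2 * ∑ i, K i →
      ∃ j ∈ J, δ * (t j - lam j * ∑ i, K i) ≤
        t j * ((n : ℝ) / 2 * ((n : ℝ) / 2 + 1) / 3) - lam j * e -
          Real.sqrt (e / (2 * ∑ i ∈ T, K i)) * Wbar j) :
    3 * δ ≤ liminf (fun k : ℕ =>
      (∑ x : TorusSite d (2 * k + 2), ∑ y : TorusSite d (2 * k + 2),
        (-1 : ℝ) ^ (∑ i, (x i).val) * (-1) ^ (∑ i, (y i).val) *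
          ∑ α : Fin 3, heisAnisoGroundCorr α (2 * k + 2) n K x y) /
        ((2 * k + 2 : ℕ) : ℝ) ^ (2 * d)) atTop := by
  have hev := heisAniso_neelOrder_of_certificate hK hmax T hT hκ J t lam Wbar hpos hW hcert
  have h2k : Tendsto (fun k : ℕ => k + 1) atTop atTop :=
    tendsto_atTop_atTop.2 fun b => ⟨b, fun k hk => by omega⟩
  have hev' := h2k.eventually hev
  refine le_liminf_of_le ?_ ?_
  · exact isCoboundedUnder_ge_of_le atTop fun k => by
      haveI : NeZero (2 * k + 2) := ⟨by omega⟩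
      exact heisAniso_neelSum_le n (2 * k + 2) K
  · filter_upwards [hev'] with k hk
    haveI : NeZero (2 * (k + 1)) := ⟨by omega⟩
    show 3 * δ ≤ (∑ x : TorusSite d (2 * (k + 1)), ∑ y : TorusSite d (2 * (k + 1)),
        (-1 : ℝ) ^ (∑ i, (x i).val) * (-1) ^ (∑ i, (y i).val) *
          ∑ α : Fin 3, heisAnisoGroundCorr α (2 * (k + 1)) n K x y) / ((2 * (k + 1) : ℕ) : ℝ) ^ (2 * d)
    rw [heisAniso_neelSum_eq n (k + 1) K]
    have hk' : δ ≤ heisAnisoStructureFactor 0 (2 * (k + 1)) n K (neelIndex (2 * (k + 1))) /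
        ((2 * (k + 1) : ℕ) : ℝ) ^ d := hk
    linarith

end NeelOrder

end Literature.MathematicalPhysics.QuantumLattice
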